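import Literature.NumberTheory.LFunctions.Zhang2022.Section12CExactBookkeeping
import Literature.NumberTheory.LFunctions.Zhang2022.Section12Eq1216EdgeExact
import Literature.NumberTheory.LFunctions.Zhang2022.NumericsSection12ExactC

/-!
# Zhang (2022) §12: the exact-reading window node `Win1217Ex` HOLDS (ZHANG-L RT-02 / R-18, leaf slot `hWin`)

Topic `Literature/NumberTheory/LFunctions/Zhang2022` (Landau–Siegel audit tree; verdict-neutral).
Y. Zhang, *Discrete mean estimates and the Landau–Siegel zero*, arXiv:2211.02515v1 (2022)
[Zhang2022LandauSiegel], §12 pp. 70–73 — **an unrefereed manuscript under adjudication; everything in this file is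
PROVED (theorems only: no new definition, no new named fact, no hypothesis); nothing here is a claim about Theorems 1–2
of the source or about Landau–Siegel zeros.**

**Result.** `Typed.Sec12C.win1217Ex_holds : ∀ c′, Typed.Sec12C.Win1217Ex c′` — the numerical node of the lane's
exact-reading re-type RT-02 (statement file `TypedSection12CExact`, decision R-18): for every `c′` and all large `D`,
`‖Σ_j (w_j/α)·main1213intEx_j + conj(Σ_j (w_j/α)·main12u049intEx_j) − 2𝔞e₂*‖ ≤ 5·10⁻⁶·𝔞` (`w = (1/2, 2, 3/2)`), i.e. the
weighted EXACT main terms of the two top ranges of (12.13) and §12.u049 (Zhang's own `𝓦_j`, `𝓦*_j` of pp. 71, 73 kept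
exact) give `2e₂*` to within `5·10⁻⁶` — what "(12.15), (12.16) ⇒ (12.17)" consumes.

**Method.**
* the `D → ∞` main value `e₂*(𝓦ˣ) + conj ē₂*(𝓦*ˣ) − 2e₂*` has norm `< 3.6·10⁻⁶`: the tree's read-out
  `Numerics.eq1217_exact_lt_36` (`NumericsSection12ExactC`, box `Numerics.E17x`; kit value `3.49·10⁻⁶`), imported by name.
* §1 the substitution `t = e^{v log P}` turning the two moments `∫₁^{P″₂/y} t^{β₆−1}(log t) dt` of the proof of Lemma 12.3
  (p. 70) at `y = P^z` into `log P·K₀(V)`, `log²P·K₁(V)` (`Numerics.K0/K1`, `β₆ log P = 3πi/2`), §2–§3 Lipschitz/size bounds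
  for `K₀, K₁`, §4 `core_window_bound`: the level-`D` bracket is within `10r` of its main value when the perturbations
  (`c′α𝓛`-corrections of (2.13), `α log(Dt₀)`) are `≤ r ≤ 1/100`; §5 the `𝔣𝔣`-window functional `Numerics.e2starW` is
  `0.05`-Lipschitz in the sup-distance of the weights.
* `frakwEx_rpow_eq`, `frakwEx_sub_wExact_le`: `‖𝓦ˣ_j(P^z) − wExact j z‖ ≤ 10r` on `[0.496, 0.5]` (`j = 1,2,3`) once
  `(530 + 26|c′| + 15c′²)·α𝓛 ≤ r` — with `α𝓛 = π𝓛⁻⁸` this is `D ≥ D₀(c′)` (`Sec12C.ell_large`); the `𝓦*ˣ`-half and the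
  `𝔤𝔥`-functional are the tree's `Sec12D.wStarEx_sub_wStarExact_le`, `Sec12D.e2starBarW_sub_le_of_close`
  (`Section12Eq1216EdgeExact`), imported by name; the weighted sums are `𝔞·e2starEx`, `𝔞·e2starBarEx`
  (`Sec12C.weighted_main1213intEx_eq/…u049…`, `Section12CExactBookkeeping`); budget
  `3.6·10⁻⁶ + 10⁻⁵·0.05 + 10⁻⁵·0.055 = 4.65·10⁻⁶ ≤ 5·10⁻⁶`.

vs PRINT: the node is the lane's exact-reading replacement (RT-02) of the printed roundings "(12.14) `+ε/4`", "(12.15)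
`+ε/2`" which are NOT reached in this reading (`Numerics.not_eq1214_exact_one`, `not_eq1215_exact`); (12.17) itself is.

## References

* Y. Zhang, arXiv:2211.02515v1 (2022), §12: proof of Lemma 12.3 p. 70 (tex L3559–L3590), (12.13)–(12.17) pp. 71–73
  (tex L3614–L3720); §2 (2.10), (2.13), (2.22). [cite: Zhang2022LandauSiegel, §12 (12.15)–(12.17)]
-/

noncomputable section

open Complex Real ComplexConjugate MeasureTheory Set intervalIntegral

namespace Literature.NumberTheory.LFunctions.Zhang2022.Sec12WinExact

open Literature.NumberTheory.LFunctions.Zhang2022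
open Literature.NumberTheory.LFunctions.Zhang2022.Numerics

/-! ## §1. The substitution `t = e^{Lv}` -/

/-- For real `x` and complex `c`: `(e^x : ℂ)^c = e^{c x}`. [folklore] -/
private theorem ofReal_exp_cpow (x : ℝ) (c : ℂ) : ((Real.exp x : ℝ) : ℂ) ^ c = cexp (c * x) := by
  rw [Complex.cpow_def_of_ne_zero (by exact_mod_cast (Real.exp_pos x).ne'), ← Complex.ofReal_log
    (Real.exp_pos x).le, Real.log_exp, mul_comm]

/-- `∫₁^{e^{LV}} t^{c−1} dt = L ∫₀^V e^{cLv} dv` (substitution `t = e^{Lv}`).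
[cite: Zhang2022LandauSiegel, §12 proof of Lemma 12.3, p. 70] -/
theorem integral_cpow_sub_one_eq (c : ℂ) (L V : ℝ) :
    ∫ t in (1:ℝ)..Real.exp (L * V), (t : ℂ) ^ (c - 1) = (L : ℂ) * ∫ v in (0:ℝ)..V, cexp (c * (L * v)) := by
  have h := intervalIntegral.integral_deriv_smul_comp' (a := 0) (b := V) (f := fun v => Real.exp (L * v))
    (f' := fun v => L * Real.exp (L * v)) (g := fun t : ℝ => (t : ℂ) ^ (c - 1))
    (fun x _ => by
      have := ((hasDerivAt_id x).const_mul L).exp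
      simpa [mul_comm] using this)
    (Continuous.continuousOn (by fun_prop))
    (by
      rintro t ⟨v, -, rfl⟩
      exact (continuousAt_ofReal_cpow_const _ _ (Or.inr (Real.exp_pos _).ne')).continuousWithinAt)
  simp only [Function.comp, mul_zero, Real.exp_zero] at h
  rw [← h, ← intervalIntegral.integral_const_mul]
  refine intervalIntegral.integral_congr fun v _ => ?_
  simp only [Complex.real_smul, ofReal_exp_cpow]
  push_cast
  rw [mul_assoc, ← Complex.exp_add, show (L : ℂ) * v + (c - 1) * ((L : ℂ) * v) = c * ((L : ℂ) * v) by ring]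

/-- `∫₁^{e^{LV}} t^{c−1} log t dt = L² ∫₀^V v e^{cLv} dv` (substitution `t = e^{Lv}`).
[cite: Zhang2022LandauSiegel, §12 proof of Lemma 12.3, p. 70] -/
theorem integral_cpow_sub_one_mul_log_eq (c : ℂ) (L V : ℝ) :
    ∫ t in (1:ℝ)..Real.exp (L * V), (t : ℂ) ^ (c - 1) * (Real.log t : ℂ) =
      (L : ℂ) ^ 2 * ∫ v in (0:ℝ)..V, (v : ℂ) * cexp (c * (L * v)) := by
  have h := intervalIntegral.integral_deriv_smul_comp' (a := 0) (b := V) (f := fun v => Real.exp (L * v))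
    (f' := fun v => L * Real.exp (L * v)) (g := fun t : ℝ => (t : ℂ) ^ (c - 1) * (Real.log t : ℂ))
    (fun x _ => by
      have := ((hasDerivAt_id x).const_mul L).exp
      simpa [mul_comm] using this)
    (Continuous.continuousOn (by fun_prop))
    (by
      rintro t ⟨v, -, rfl⟩
      refine ContinuousAt.continuousWithinAt ?_
      refine (continuousAt_ofReal_cpow_const _ _ (Or.inr (Real.exp_pos _).ne')).mul ?_
      exact (Complex.continuous_ofReal.continuousAt).comp
        (Real.continuousAt_log (Real.exp_pos _).ne'))
  simp only [Function.comp, mul_zero, Real.exp_zero] at h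
  rw [← h, ← intervalIntegral.integral_const_mul]
  refine intervalIntegral.integral_congr fun v _ => ?_
  simp only [Complex.real_smul, ofReal_exp_cpow, Real.log_exp]
  push_cast
  have e : cexp (c * ((L : ℂ) * v)) = cexp ((L : ℂ) * v) * cexp ((c - 1) * ((L : ℂ) * v)) := by
    rw [← Complex.exp_add]; congr 1; ring
  rw [e]; ring

/-! ## §2. Size and Lipschitz bounds for `K₀`, `K₁` -/

/-- `‖K₀(x) − K₀(y)‖ ≤ |x − y|` (the integrand `e^{3πiz/2}` is unimodular).
[cite: Zhang2022LandauSiegel, §12 proof of Lemma 12.3, p. 70] -/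
theorem norm_K0_sub_K0_le (x y : ℝ) : ‖K0 x - K0 y‖ ≤ |x - y| := by
  have hint : ∀ a b : ℝ, IntervalIntegrable (fun z : ℝ => cexp (3 * π * I * z / 2)) MeasureTheory.volume a b :=
    fun a b => (Continuous.intervalIntegrable (by fun_prop) _ _)
  unfold K0
  rw [intervalIntegral.integral_interval_sub_left (hint 0 x) (hint 0 y)]
  have h := intervalIntegral.norm_integral_le_of_norm_le_const (a := y) (b := x) (C := 1)
    (f := fun z : ℝ => cexp (3 * π * I * z / 2)) (fun z _ => by
      rw [show 3 * (π : ℂ) * I * z / 2 = ((3 * π * z / 2 : ℝ) : ℂ) * I by push_cast; ring,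
        Complex.norm_exp_ofReal_mul_I])
  simpa using h

/-- `‖K₀(x)‖ ≤ |x|`. [cite: Zhang2022LandauSiegel, §12 proof of Lemma 12.3, p. 70] -/
theorem norm_K0_le (x : ℝ) : ‖K0 x‖ ≤ |x| := by
  have h := norm_K0_sub_K0_le x 0
  have h0 : K0 0 = 0 := by unfold K0; simp
  simpa [h0] using h

/-- `‖K₁(x) − K₁(y)‖ ≤ max |x| |y| · |x − y|` (the integrand `z e^{3πiz/2}` has modulus `|z|`).
[cite: Zhang2022LandauSiegel, §12 proof of Lemma 12.3, p. 70] -/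
theorem norm_K1_sub_K1_le (x y : ℝ) : ‖K1 x - K1 y‖ ≤ max |x| |y| * |x - y| := by
  have hint : ∀ a b : ℝ, IntervalIntegrable (fun z : ℝ => (z : ℂ) * cexp (3 * π * I * z / 2))
      MeasureTheory.volume a b :=
    fun a b => (Continuous.intervalIntegrable (by fun_prop) _ _)
  unfold K1
  rw [intervalIntegral.integral_interval_sub_left (hint 0 x) (hint 0 y)]
  have h := intervalIntegral.norm_integral_le_of_norm_le_const (a := y) (b := x) (C := max |x| |y|)
    (f := fun z : ℝ => (z : ℂ) * cexp (3 * π * I * z / 2)) (fun z hz => by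
      rw [norm_mul, show 3 * (π : ℂ) * I * z / 2 = ((3 * π * z / 2 : ℝ) : ℂ) * I by push_cast; ring,
        Complex.norm_exp_ofReal_mul_I, mul_one, Complex.norm_real, Real.norm_eq_abs]
      obtain ⟨h1, h2⟩ := hz
      rw [abs_le]
      constructor
      · have : -max |x| |y| ≤ min y x := by
          rw [le_min_iff]; constructor
          · linarith [neg_abs_le y, le_max_right |x| |y|]
          · linarith [neg_abs_le x, le_max_left |x| |y|]
        linarith
      · calc z ≤ max y x := h2
          _ ≤ max |x| |y| := by
              rw [max_comm]; exact max_le_max (le_abs_self x) (le_abs_self y))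
  simpa using h

/-- `‖K₁(x)‖ ≤ |x|²` (crude). [cite: Zhang2022LandauSiegel, §12 proof of Lemma 12.3, p. 70] -/
theorem norm_K1_le (x : ℝ) : ‖K1 x‖ ≤ |x| ^ 2 := by
  have h := norm_K1_sub_K1_le x 0
  have h0 : K1 0 = 0 := by unfold K1; simp
  simp only [h0, sub_zero, abs_zero] at h
  rw [max_eq_left (abs_nonneg x)] at h
  nlinarith [h]

/-- `K₀`, `K₁` are continuous (closed forms `Numerics.K0_closed`, `K1_closed`). [folklore] -/
private theorem continuous_K0_K1 : Continuous K0 ∧ Continuous K1 := by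
  constructor
  · have e : K0 = fun v => (wK : ℂ) * I * (1 - cexp ((((3/2 : ℝ) * v * π : ℝ) : ℂ) * I)) := by
      funext v; exact K0_closed v
    rw [e]; fun_prop
  · have e : K1 = fun v =>
        (((wK : ℂ)) ^ 2 - (wK : ℂ) * I * v) * cexp ((((3/2 : ℝ) * v * π : ℝ) : ℂ) * I) - (wK : ℂ) ^ 2 := by
      funext v; exact K1_closed v
    rw [e]; fun_prop

/-! ## §3. Algebraic perturbation inequalities -/

/-- `‖a′b′ − ab‖ ≤ ‖a′ − a‖‖b′‖ + ‖a‖‖b′ − b‖`. [folklore] -/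
private theorem norm_mul_sub_mul_le' (a a' b b' : ℂ) : ‖a' * b' - a * b‖ ≤ ‖a' - a‖ * ‖b'‖ + ‖a‖ * ‖b' - b‖ := by
  have e : a' * b' - a * b = (a' - a) * b' + a * (b' - b) := by ring
  rw [e]
  exact (norm_add_le _ _).trans (by rw [norm_mul, norm_mul])

/-! ## §4. The core perturbation bound (main values of the proof of Lemma 12.3 vs their level-`D` twins) -/

/-- `π ≤ 3.2` and `π² ≤ 10.24` (crude). [folklore] -/
private theorem pi_le_32 : π ≤ 3.2 ∧ π ^ 2 ≤ 10.24 := by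
  have h := Real.pi_lt_d2
  constructor
  · linarith
  · nlinarith [Real.pi_pos]

/-- **Core bound.** For `0 ≤ n ≤ 6`, `|q| ≤ 7/2`, `u ∈ [0, 0.004]` and perturbations `|ρ|, |σ|, m ≤ r ≤ 1/100` (`m ≥ 0`):
the level-`D` bracket `−e^{3πiu/2 − 3im/2}[1 + π²(n+ρ)K₁(V) − (u − m/π)(iπ(q+σ) − π²(n+ρ)K₀(V))]`, `V = 0.004 − u + m/π`,
is within `10r` of its main value `−e^{3πiu/2}[1 + π²nK₁(V₀) − u(iπq − π²nK₀(V₀))]`, `V₀ = 0.004 − u`.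
[cite: Zhang2022LandauSiegel, §12 proof of Lemma 12.3, p. 70] -/
theorem core_window_bound {n q u ρ σ m r : ℝ} (hn0 : 0 ≤ n) (hn : n ≤ 6) (hq : |q| ≤ 7 / 2)
    (hu0 : 0 ≤ u) (hu : u ≤ 0.004) (hρ : |ρ| ≤ r) (hσ : |σ| ≤ r) (hm0 : 0 ≤ m) (hm : m ≤ r)
    (hr : r ≤ 1 / 100) :
    ‖-(cexp (3 * π * I * u / 2 - 3 * I * m / 2) *
          (1 + π ^ 2 * (n + ρ) * K1 (0.004 - u + m / π) -
            (u - m / π) * (I * π * (q + σ) - π ^ 2 * (n + ρ) * K0 (0.004 - u + m / π)))) -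
        -(cexp (3 * π * I * u / 2) *
          (1 + π ^ 2 * n * K1 (0.004 - u) - u * (I * π * q - π ^ 2 * n * K0 (0.004 - u))))‖ ≤ 10 * r := by
  obtain ⟨hπ1, hπ2⟩ := pi_le_32
  have hπ3 : 3 ≤ π := Real.pi_gt_three.le
  have hπ0 : 0 < π := Real.pi_pos
  have hr0 : 0 ≤ r := hm0.trans hm
  -- the two window abscissae
  obtain ⟨V₀, hV₀⟩ : ∃ V₀ : ℝ, V₀ = 0.004 - u := ⟨_, rfl⟩
  obtain ⟨V, hV⟩ : ∃ V : ℝ, V = 0.004 - u + m / π := ⟨_, rfl⟩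
  have hV₀0 : 0 ≤ V₀ := by rw [hV₀]; linarith
  have hV₀1 : V₀ ≤ 0.004 := by rw [hV₀]; linarith
  have hmπ : m / π ≤ r / 3 := by
    rw [div_le_iff₀ hπ0]; nlinarith
  have hmπ0 : 0 ≤ m / π := div_nonneg hm0 hπ0.le
  have hVV₀ : V - V₀ = m / π := by rw [hV, hV₀]; ring
  have hV0 : 0 ≤ V := by rw [hV]; linarith
  have hV1 : V ≤ 0.0074 := by rw [hV]; linarith
  -- K₀, K₁ data
  have k1d : ‖K1 V - K1 V₀‖ ≤ 0.0025 * r := by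
    refine (norm_K1_sub_K1_le V V₀).trans ?_
    rw [abs_of_nonneg hV0, abs_of_nonneg hV₀0, hVV₀, abs_of_nonneg hmπ0]
    calc max V V₀ * (m / π) ≤ 0.0074 * (r / 3) :=
          mul_le_mul (max_le hV1 (by linarith)) hmπ hmπ0 (by norm_num)
      _ ≤ 0.0025 * r := by linarith
  have k1n : ‖K1 V‖ ≤ 0.000055 := by
    refine (norm_K1_le V).trans ?_
    rw [abs_of_nonneg hV0]; nlinarith
  have k1n₀ : ‖K1 V₀‖ ≤ 0.000016 := by
    refine (norm_K1_le V₀).trans ?_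
    rw [abs_of_nonneg hV₀0]; nlinarith
  have k0d : ‖K0 V - K0 V₀‖ ≤ r / 3 := by
    refine (norm_K0_sub_K0_le V V₀).trans ?_
    rw [hVV₀, abs_of_nonneg hmπ0]; exact hmπ
  have k0n : ‖K0 V‖ ≤ 0.0074 := (norm_K0_le V).trans (by rw [abs_of_nonneg hV0]; exact hV1)
  have k0n₀ : ‖K0 V₀‖ ≤ 0.004 := (norm_K0_le V₀).trans (by rw [abs_of_nonneg hV₀0]; exact hV₀1)
  -- the coefficient N = π²(n+ρ) vs N₀ = π²n
  obtain ⟨N, hN⟩ : ∃ N : ℂ, N = (π : ℂ) ^ 2 * (n + ρ) := ⟨_, rfl⟩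
  obtain ⟨N₀, hN₀⟩ : ∃ N₀ : ℂ, N₀ = (π : ℂ) ^ 2 * n := ⟨_, rfl⟩
  have Nd : ‖N - N₀‖ ≤ 10.3 * r := by
    have e : N - N₀ = ((π ^ 2 * ρ : ℝ) : ℂ) := by rw [hN, hN₀]; push_cast; ring
    rw [e, Complex.norm_real, Real.norm_eq_abs, abs_mul, abs_of_nonneg (by positivity)]
    calc π ^ 2 * |ρ| ≤ 10.24 * r := mul_le_mul hπ2 hρ (abs_nonneg _) (by norm_num)
      _ ≤ 10.3 * r := by linarith
  have N₀n : ‖N₀‖ ≤ 61.5 := by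
    have e : N₀ = ((π ^ 2 * n : ℝ) : ℂ) := by rw [hN₀]; push_cast; ring
    rw [e, Complex.norm_real, Real.norm_eq_abs, abs_of_nonneg (by positivity)]
    calc π ^ 2 * n ≤ 10.24 * 6 := mul_le_mul hπ2 hn hn0 (by norm_num)
      _ ≤ 61.5 := by norm_num
  have Nn : ‖N‖ ≤ 61.7 := by
    have := norm_le_insert' N N₀   -- ‖N‖ ≤ ‖N₀‖ + ‖N - N₀‖
    linarith
  -- A = N K₁(V) vs A₀ = N₀ K₁(V₀)
  have Ad : ‖N * K1 V - N₀ * K1 V₀‖ ≤ 0.16 * r := by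
    have h := norm_mul_sub_mul_le' N₀ N (K1 V₀) (K1 V)
    have h1 : ‖N - N₀‖ * ‖K1 V‖ ≤ (10.3 * r) * 0.000055 :=
      mul_le_mul Nd k1n (norm_nonneg _) (by positivity)
    have h2 : ‖N₀‖ * ‖K1 V - K1 V₀‖ ≤ 61.5 * (0.0025 * r) :=
      mul_le_mul N₀n k1d (norm_nonneg _) (by norm_num)
    linarith
  have A₀n : ‖N₀ * K1 V₀‖ ≤ 0.001 := by
    rw [norm_mul]
    calc ‖N₀‖ * ‖K1 V₀‖ ≤ 61.5 * 0.000016 := mul_le_mul N₀n k1n₀ (norm_nonneg _) (by norm_num)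
      _ ≤ 0.001 := by norm_num
  -- G = iπ(q+σ) − N K₀(V) vs G₀ = iπq − N₀K₀(V₀)
  have Gd : ‖(I * π * (q + σ) - N * K0 V) - (I * π * q - N₀ * K0 V₀)‖ ≤ 23.8 * r := by
    have e : (I * π * (q + σ) - N * K0 V) - (I * π * q - N₀ * K0 V₀) =
        I * π * σ - (N * K0 V - N₀ * K0 V₀) := by ring
    rw [e]
    have hs : ‖I * (π : ℂ) * σ‖ ≤ 3.2 * r := by
      rw [norm_mul, norm_mul, Complex.norm_I, one_mul, Complex.norm_real, Complex.norm_real,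
        Real.norm_eq_abs, Real.norm_eq_abs, abs_of_pos hπ0]
      exact mul_le_mul hπ1 hσ (abs_nonneg _) (by norm_num)
    have h := norm_mul_sub_mul_le' N₀ N (K0 V₀) (K0 V)
    have h1 : ‖N - N₀‖ * ‖K0 V‖ ≤ (10.3 * r) * 0.0074 :=
      mul_le_mul Nd k0n (norm_nonneg _) (by positivity)
    have h2 : ‖N₀‖ * ‖K0 V - K0 V₀‖ ≤ 61.5 * (r / 3) :=
      mul_le_mul N₀n k0d (norm_nonneg _) (by norm_num)
    calc ‖I * ↑π * ↑σ - (N * K0 V - N₀ * K0 V₀)‖ ≤ ‖I * ↑π * ↑σ‖ + ‖N * K0 V - N₀ * K0 V₀‖ := norm_sub_le _ _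
      _ ≤ 3.2 * r + ((10.3 * r) * 0.0074 + 61.5 * (r / 3)) := by linarith
      _ ≤ 23.8 * r := by linarith
  have G₀n : ‖I * π * q - N₀ * K0 V₀‖ ≤ 11.45 := by
    have hs : ‖I * (π : ℂ) * q‖ ≤ 3.2 * (7 / 2) := by
      rw [norm_mul, norm_mul, Complex.norm_I, one_mul, Complex.norm_real, Complex.norm_real,
        Real.norm_eq_abs, Real.norm_eq_abs, abs_of_pos hπ0]
      exact mul_le_mul hπ1 hq (abs_nonneg _) (by norm_num)
    have h2 : ‖N₀ * K0 V₀‖ ≤ 61.5 * 0.004 := by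
      rw [norm_mul]; exact mul_le_mul N₀n k0n₀ (norm_nonneg _) (by norm_num)
    calc ‖I * ↑π * ↑q - N₀ * K0 V₀‖ ≤ ‖I * ↑π * ↑q‖ + ‖N₀ * K0 V₀‖ := norm_sub_le _ _
      _ ≤ 11.45 := by linarith
  have Gn : ‖I * π * (q + σ) - N * K0 V‖ ≤ 11.7 := by
    have := norm_le_insert' (I * π * (q + σ) - N * K0 V) (I * π * q - N₀ * K0 V₀)
    linarith
  -- H = (u − m/π)G vs H₀ = uG₀
  have Hd : ‖((u : ℂ) - m / π) * (I * π * (q + σ) - N * K0 V) - (u : ℂ) * (I * π * q - N₀ * K0 V₀)‖ ≤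
      4 * r := by
    have h := norm_mul_sub_mul_le' (u : ℂ) ((u : ℂ) - m / π) (I * π * q - N₀ * K0 V₀)
      (I * π * (q + σ) - N * K0 V)
    have e1 : ‖((u : ℂ) - m / π) - u‖ = m / π := by
      rw [show ((u : ℂ) - m / π) - u = -(((m / π : ℝ)) : ℂ) by push_cast; ring, norm_neg,
        Complex.norm_real, Real.norm_eq_abs, abs_of_nonneg hmπ0]
    have e2 : ‖(u : ℂ)‖ = u := by rw [Complex.norm_real, Real.norm_eq_abs, abs_of_nonneg hu0]
    rw [e1, e2] at h
    have h1 : m / π * ‖I * ↑π * (↑q + ↑σ) - N * K0 V‖ ≤ (r / 3) * 11.7 := mul_le_mul hmπ Gn (norm_nonneg _) (by positivity)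
    have h2 : u * ‖I * ↑π * (↑q + ↑σ) - N * K0 V - (I * ↑π * ↑q - N₀ * K0 V₀)‖ ≤ 0.004 * (23.8 * r) :=
      mul_le_mul hu Gd (norm_nonneg _) (by norm_num)
    linarith
  have H₀n : ‖(u : ℂ) * (I * π * q - N₀ * K0 V₀)‖ ≤ 0.046 := by
    rw [norm_mul, Complex.norm_real, Real.norm_eq_abs, abs_of_nonneg hu0]
    calc u * ‖I * ↑π * ↑q - N₀ * K0 V₀‖ ≤ 0.004 * 11.45 := mul_le_mul hu G₀n (norm_nonneg _) (by norm_num)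
      _ ≤ 0.046 := by norm_num
  -- Φ vs Φ₀
  obtain ⟨Φ, hΦ⟩ : ∃ Φ : ℂ, Φ = 1 + N * K1 V - ((u : ℂ) - m / π) * (I * π * (q + σ) - N * K0 V) :=
    ⟨_, rfl⟩
  obtain ⟨Φ₀, hΦ₀⟩ : ∃ Φ₀ : ℂ, Φ₀ = 1 + N₀ * K1 V₀ - (u : ℂ) * (I * π * q - N₀ * K0 V₀) := ⟨_, rfl⟩
  have Φd : ‖Φ - Φ₀‖ ≤ 4.16 * r := by
    have e : Φ - Φ₀ = (N * K1 V - N₀ * K1 V₀) -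
        (((u : ℂ) - m / π) * (I * π * (q + σ) - N * K0 V) - (u : ℂ) * (I * π * q - N₀ * K0 V₀)) := by
      rw [hΦ, hΦ₀]; ring
    rw [e]
    exact (norm_sub_le _ _).trans (by linarith)
  have Φ₀n : ‖Φ₀‖ ≤ 1.047 := by
    rw [hΦ₀]
    calc ‖1 + N₀ * K1 V₀ - (u : ℂ) * (I * π * q - N₀ * K0 V₀)‖
        ≤ ‖(1 : ℂ) + N₀ * K1 V₀‖ + ‖(u : ℂ) * (I * π * q - N₀ * K0 V₀)‖ := norm_sub_le _ _
      _ ≤ (‖(1 : ℂ)‖ + ‖N₀ * K1 V₀‖) + ‖(u : ℂ) * (I * π * q - N₀ * K0 V₀)‖ := by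
          gcongr; exact norm_add_le _ _
      _ ≤ (1 + 0.001) + 0.046 := by rw [norm_one]; linarith
      _ ≤ 1.047 := by norm_num
  have Φn : ‖Φ‖ ≤ 1.089 := by
    have := norm_le_insert' Φ Φ₀
    linarith
  -- the phases
  obtain ⟨E₀, hE₀⟩ : ∃ E₀ : ℂ, E₀ = cexp (3 * π * I * u / 2) := ⟨_, rfl⟩
  obtain ⟨E, hE⟩ : ∃ E : ℂ, E = cexp (3 * π * I * u / 2 - 3 * I * m / 2) := ⟨_, rfl⟩
  have hE₀n : ‖E₀‖ = 1 := by
    rw [hE₀, show 3 * (π : ℂ) * I * u / 2 = ((3 * π * u / 2 : ℝ) : ℂ) * I by push_cast; ring,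
      Complex.norm_exp_ofReal_mul_I]
  have hEE₀ : E = E₀ * cexp (-(((3 * m / 2 : ℝ) : ℂ)) * I) := by
    rw [hE, hE₀, ← Complex.exp_add]; congr 1; push_cast; ring
  have Ed : ‖E - E₀‖ ≤ 1.5 * r := by
    have e : E - E₀ = E₀ * (cexp (I * ((-(3 * m / 2) : ℝ) : ℂ)) - 1) := by
      rw [hEE₀]; push_cast; ring_nf
    rw [e, norm_mul, hE₀n, one_mul]
    refine (Real.norm_exp_I_mul_ofReal_sub_one_le).trans ?_
    rw [Real.norm_eq_abs, abs_neg, abs_of_nonneg (by positivity)]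
    linarith
  -- assemble
  have e : -(E * Φ) - -(E₀ * Φ₀) = -(E * Φ - E₀ * Φ₀) := by ring
  have hfinal : ‖E * Φ - E₀ * Φ₀‖ ≤ 10 * r := by
    have h := norm_mul_sub_mul_le' E₀ E Φ₀ Φ
    rw [hE₀n, one_mul] at h
    have h1 : ‖E - E₀‖ * ‖Φ‖ ≤ (1.5 * r) * 1.089 := mul_le_mul Ed Φn (norm_nonneg _) (by positivity)
    linarith
  -- match the displayed shape
  have eΦ : (1 + π ^ 2 * (n + ρ) * K1 (0.004 - u + m / π) -
      (u - m / π) * (I * π * (q + σ) - π ^ 2 * (n + ρ) * K0 (0.004 - u + m / π)) : ℂ) = Φ := by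
    rw [hΦ, hN, hV]
  have eΦ₀ : (1 + π ^ 2 * n * K1 (0.004 - u) - u * (I * π * q - π ^ 2 * n * K0 (0.004 - u)) : ℂ) = Φ₀ := by
    rw [hΦ₀, hN₀, hV₀]
  rw [eΦ, eΦ₀, ← hE, ← hE₀, e, norm_neg]
  exact hfinal

/-! ## §5. The `𝔣𝔣`-window functional `e2starW` is `0.05`-Lipschitz in the sup-distance of the weights -/

/-- `|𝔣𝔣_{a,k}(x)| ≤ 1.0002` for `|a| ≤ 3/2`, `0 ≤ x ≤ 0.004` (`|e^{kπix}| = 1`, `|1 + aπix| = √(1 + a²π²x²)`).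
[cite: Zhang2022LandauSiegel, §8 (8.13)–(8.18) p.48] -/
theorem norm_ffF_le_window {a k : ℚ} (ha : |(a : ℝ)| ≤ 3 / 2) {x : ℝ} (hx0 : 0 ≤ x) (hx : x ≤ 0.004) :
    ‖ffF a k x‖ ≤ 1.0002 := by
  rw [ffF, norm_mul]
  have h2 : ‖cexp ((k : ℂ) * π * I * x)‖ = 1 := by
    have e : (k : ℂ) * π * I * x = (((k : ℝ) * π * x : ℝ) : ℂ) * I := by push_cast; ring
    rw [e, Complex.norm_exp_ofReal_mul_I]
  rw [h2, mul_one]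
  have e1 : (1 : ℂ) + a * π * I * x = ((1 : ℝ) : ℂ) + (((a : ℝ) * π * x : ℝ) : ℂ) * I := by
    push_cast; ring
  have hsq : ‖(1 : ℂ) + a * π * I * x‖ ^ 2 = 1 + ((a : ℝ) * π * x) ^ 2 := by
    rw [e1, Complex.sq_norm, Complex.normSq_add_mul_I]; ring
  have hb : |(a : ℝ) * π * x| ≤ 3 / 2 * 3.15 * 0.004 := by
    rw [abs_mul, abs_mul, abs_of_pos Real.pi_pos, abs_of_nonneg hx0]
    have hπ := Real.pi_lt_d2
    gcongr
  have hb2 : ((a : ℝ) * π * x) ^ 2 ≤ (3 / 2 * 3.15 * 0.004) ^ 2 := by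
    rw [← sq_abs]; exact pow_le_pow_left₀ (abs_nonneg _) hb 2
  refine (pow_le_pow_iff_left₀ (norm_nonneg _) (by norm_num) two_ne_zero).mp ?_
  rw [hsq]
  nlinarith

/-- `∫_{0.496}^{b} |𝔣𝔣_{a,k}(b − z)|dz ≤ 1.0002(b − 0.496)` for `0.496 ≤ b ≤ 0.5`, `|a| ≤ 3/2`.
[cite: Zhang2022LandauSiegel, §12 (12.13) p.71] -/
theorem integral_norm_ffF_le_window {a k : ℚ} (ha : |(a : ℝ)| ≤ 3 / 2) {b : ℝ} (hb : 0.496 ≤ b)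
    (hb' : b ≤ 0.5) : ∫ z in (0.496:ℝ)..b, ‖ffF a k (b - z)‖ ≤ 1.0002 * (b - 0.496) := by
  have h := intervalIntegral.norm_integral_le_of_norm_le_const (a := (0.496 : ℝ)) (b := b)
    (f := fun z => ‖ffF a k (b - z)‖) (C := 1.0002) (fun z hz => by
      rw [Set.uIoc_of_le hb] at hz
      rw [norm_norm]
      exact norm_ffF_le_window ha (by linarith [hz.2]) (by linarith [hz.1]))
  rw [Real.norm_eq_abs, abs_of_nonneg (by linarith : (0 : ℝ) ≤ b - 0.496)] at h
  exact (le_abs_self _).trans h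

/-- `‖ι₃‖ ≤ 1.0319`, `‖ι₄‖ ≤ 1.7478` ((2.26)). [cite: Zhang2022LandauSiegel, §2 (2.26) p.9] -/
theorem norm_iota34_le' : ‖iota3‖ ≤ 1.0319 ∧ ‖iota4‖ ≤ 1.7478 := by
  have hre3 : iota3.re = -1.00635 := by simp [iota3]
  have him3 : iota3.im = -0.22789 := by simp [iota3]
  have hre4 : iota4.re = -0.68738 := by simp [iota4]
  have him4 : iota4.im = 1.60688 := by simp [iota4]
  have hsq3 : ‖iota3‖ ^ 2 = 1.00635 ^ 2 + 0.22789 ^ 2 := by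
    rw [Complex.sq_norm, Complex.normSq_apply, hre3, him3]; ring
  have hsq4 : ‖iota4‖ ^ 2 = 0.68738 ^ 2 + 1.60688 ^ 2 := by
    rw [Complex.sq_norm, Complex.normSq_apply, hre4, him4]; ring
  constructor
  · refine (pow_le_pow_iff_left₀ (norm_nonneg _) (by norm_num) two_ne_zero).mp ?_
    rw [hsq3]; norm_num
  · refine (pow_le_pow_iff_left₀ (norm_nonneg _) (by norm_num) two_ne_zero).mp ?_
    rw [hsq4]; norm_num

/-- The `𝔣𝔣`-profiles by `j`: `ffj6 j = 𝔣𝔣_{a₆,3/2}`, `ffj7 j = 𝔣𝔣_{a₇,5/2}` with `|a₆|, |a₇| ≤ 3/2` (`j = 1,2,3`).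
[cite: Zhang2022LandauSiegel, §8 (8.13)–(8.18) p.48] -/
theorem ffj_profiles {j : ℕ} (hj : j ∈ ({1, 2, 3} : Finset ℕ)) :
    ∃ a6 a7 : ℚ, |(a6 : ℝ)| ≤ 3 / 2 ∧ |(a7 : ℝ)| ≤ 3 / 2 ∧ ffj6 j = ffF a6 (3/2) ∧ ffj7 j = ffF a7 (5/2) := by
  simp only [Finset.mem_insert, Finset.mem_singleton] at hj
  rcases hj with rfl | rfl | rfl
  · exact ⟨1/2, 3/2, by norm_num, by norm_num, rfl, rfl⟩
  · exact ⟨-1/2, 1/2, by norm_num, by norm_num, rfl, rfl⟩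
  · exact ⟨-3/2, -1/2, by norm_num, by norm_num, rfl, rfl⟩

/-- **`‖e2starW w − e2starW w′‖ ≤ 0.05·δ`** whenever `‖w_j − w′_j‖ ≤ δ` on `[0.496, 0.5]` (`j = 1,2,3`; both weight
families continuous): window lengths `0.002`, `0.004`, `|𝔣𝔣| ≤ 1.0002`, `‖ι₃‖ ≤ 1.032`, `‖ι₄‖ ≤ 1.748`, `1/(0.504π)`.
[cite: Zhang2022LandauSiegel, §12 (12.13)–(12.15) p.72] -/
theorem e2starW_sub_le_of_close {w w' : ℕ → ℝ → ℂ} {δ : ℝ} (hδ0 : 0 ≤ δ)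
    (hw : ∀ j ∈ ({1, 2, 3} : Finset ℕ), Continuous (w j)) (hw' : ∀ j ∈ ({1, 2, 3} : Finset ℕ), Continuous (w' j))
    (hδ : ∀ j ∈ ({1, 2, 3} : Finset ℕ), ∀ z ∈ Set.Icc (0.496 : ℝ) 0.5, ‖w j z - w' j z‖ ≤ δ) :
    ‖e2starW w - e2starW w'‖ ≤ δ * 0.05 := by
  -- window perturbation
  have pert : ∀ {a b : ℝ}, a ≤ b → b ≤ 0.5 → 0.496 ≤ a → ∀ {f : ℝ → ℂ}, Continuous f →
      ∀ j ∈ ({1, 2, 3} : Finset ℕ),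
        ‖(∫ z in a..b, f z * w j z) - ∫ z in a..b, f z * w' j z‖ ≤ δ * ∫ z in a..b, ‖f z‖ := by
    intro a b hab hb ha f hf j hj
    have hi1 : IntervalIntegrable (fun z : ℝ => f z * w j z) MeasureTheory.volume a b :=
      (hf.mul (hw j hj)).intervalIntegrable _ _
    have hi2 : IntervalIntegrable (fun z : ℝ => f z * w' j z) MeasureTheory.volume a b :=
      (hf.mul (hw' j hj)).intervalIntegrable _ _
    rw [← intervalIntegral.integral_sub hi1 hi2]
    have e : (fun z : ℝ => f z * w j z - f z * w' j z) = fun z : ℝ => f z * (w j z - w' j z) := by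
      funext z; ring
    rw [e, ← intervalIntegral.integral_const_mul]
    refine intervalIntegral.norm_integral_le_of_norm_le hab ?_ ?_
    · refine Filter.Eventually.of_forall fun z hz => ?_
      rw [norm_mul, mul_comm]
      exact mul_le_mul_of_nonneg_right (hδ j hj z ⟨ha.trans hz.1.le, hz.2.trans hb⟩) (norm_nonneg _)
    · exact (Continuous.norm hf).intervalIntegrable _ _ |>.const_mul δ
  -- per-`j` window differences
  have dj : ∀ j ∈ ({1, 2, 3} : Finset ℕ), ‖Z1214 w j - Z1214 w' j‖ ≤ δ * 0.0182 := by
    intro j hj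
    obtain ⟨a6, a7, ha6, ha7, e6, e7⟩ := ffj_profiles hj
    have h6 := pert (a := 0.496) (b := 0.498) (by norm_num) (by norm_num) (by norm_num)
      (f := fun z => ffF a6 (3/2) (0.498 - z)) ((continuous_ffF a6 (3/2)).comp
      (continuous_const.sub continuous_id)) j hj
    have h7 := pert (a := 0.496) (b := 0.5) (by norm_num) (by norm_num) (by norm_num)
      (f := fun z => ffF a7 (5/2) (0.5 - z)) ((continuous_ffF a7 (5/2)).comp
      (continuous_const.sub continuous_id)) j hj
    have i6 := integral_norm_ffF_le_window (k := 3/2) ha6 (b := 0.498) (by norm_num) (by norm_num)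
    have i7 := integral_norm_ffF_le_window (k := 5/2) ha7 (b := 0.5) (by norm_num) (by norm_num)
    obtain ⟨hι3, hι4⟩ := norm_iota34_le'
    have e : Z1214 w j - Z1214 w' j =
        conj iota3 * ((∫ z in (0.496:ℝ)..0.498, ffF a6 (3/2) (0.498 - z) * w j z) -
            ∫ z in (0.496:ℝ)..0.498, ffF a6 (3/2) (0.498 - z) * w' j z) / 0.498 +
          conj iota4 * ((∫ z in (0.496:ℝ)..0.5, ffF a7 (5/2) (0.5 - z) * w j z) -
            ∫ z in (0.496:ℝ)..0.5, ffF a7 (5/2) (0.5 - z) * w' j z) / 0.5 := by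
      unfold Numerics.Z1214 Numerics.I6 Numerics.I7; rw [e6, e7]; ring
    rw [e]
    have n498 : ‖(0.498 : ℂ)‖ = 0.498 := by
      rw [show (0.498 : ℂ) = ((0.498 : ℝ) : ℂ) by norm_num, Complex.norm_real]; norm_num
    have n5 : ‖(0.5 : ℂ)‖ = 0.5 := by
      rw [show (0.5 : ℂ) = ((0.5 : ℝ) : ℂ) by norm_num, Complex.norm_real]; norm_num
    have t6 : ‖conj iota3 * ((∫ z in (0.496:ℝ)..0.498, ffF a6 (3/2) (0.498 - z) * w j z) -
        ∫ z in (0.496:ℝ)..0.498, ffF a6 (3/2) (0.498 - z) * w' j z) / 0.498‖ ≤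
        1.0319 * (δ * (1.0002 * (0.498 - 0.496))) / 0.498 := by
      rw [norm_div, norm_mul, RCLike.norm_conj, n498]
      gcongr
      exact h6.trans (by gcongr)
    have t7 : ‖conj iota4 * ((∫ z in (0.496:ℝ)..0.5, ffF a7 (5/2) (0.5 - z) * w j z) -
        ∫ z in (0.496:ℝ)..0.5, ffF a7 (5/2) (0.5 - z) * w' j z) / 0.5‖ ≤
        1.7478 * (δ * (1.0002 * (0.5 - 0.496))) / 0.5 := by
      rw [norm_div, norm_mul, RCLike.norm_conj, n5]
      gcongr
      exact h7.trans (by gcongr)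
    refine (norm_add_le _ _).trans ?_
    refine (add_le_add t6 t7).trans ?_
    have e2 : 1.0319 * (δ * (1.0002 * (0.498 - 0.496))) / 0.498 + 1.7478 * (δ * (1.0002 * (0.5 - 0.496))) / 0.5
        = δ * (1.0319 * 1.0002 * (0.498 - 0.496) / 0.498 + 1.7478 * 1.0002 * (0.5 - 0.496) / 0.5) := by ring
    rw [e2]
    exact mul_le_mul_of_nonneg_left (by norm_num) hδ0
  have d1 := dj 1 (by simp); have d2 := dj 2 (by simp); have d3 := dj 3 (by simp)
  have e : e2starW w - e2starW w' = ((1 / (0.504 * π) : ℝ) : ℂ) *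
      (1 / 2 * (Z1214 w 1 - Z1214 w' 1) + 2 * (Z1214 w 2 - Z1214 w' 2) + 3 / 2 * (Z1214 w 3 - Z1214 w' 3)) := by
    unfold e2starW; ring
  have hπ := Real.pi_pos
  have hπ3 := Real.pi_gt_three
  have hc : ‖((1 / (0.504 * π) : ℝ) : ℂ)‖ = 1 / (0.504 * π) := by
    rw [Complex.norm_real, Real.norm_of_nonneg (by positivity)]
  rw [e, norm_mul, hc]
  have hn3 := norm_add₃_le (a := 1 / 2 * (Z1214 w 1 - Z1214 w' 1)) (b := 2 * (Z1214 w 2 - Z1214 w' 2))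
    (c := 3 / 2 * (Z1214 w 3 - Z1214 w' 3))
  rw [norm_mul, norm_mul, norm_mul] at hn3
  have k1 : ‖(1 / 2 : ℂ)‖ = 1 / 2 := by norm_num
  have k2 : ‖(2 : ℂ)‖ = 2 := by norm_num
  have k3 : ‖(3 / 2 : ℂ)‖ = 3 / 2 := by norm_num
  rw [k1, k2, k3] at hn3
  have hin : 0 < 1 / (0.504 * π) := by positivity
  have hsum : ‖1 / 2 * (Z1214 w 1 - Z1214 w' 1) + 2 * (Z1214 w 2 - Z1214 w' 2) +
      3 / 2 * (Z1214 w 3 - Z1214 w' 3)‖ ≤ 4 * (δ * 0.0182) := by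
    refine hn3.trans ?_; nlinarith
  calc 1 / (0.504 * π) * ‖1 / 2 * (Z1214 w 1 - Z1214 w' 1) + 2 * (Z1214 w 2 - Z1214 w' 2) +
        3 / 2 * (Z1214 w 3 - Z1214 w' 3)‖ ≤ 1 / (0.504 * π) * (4 * (δ * 0.0182)) :=
        mul_le_mul_of_nonneg_left hsum hin.le
    _ = δ * (0.0728 / (0.504 * π)) := by field_simp; ring
    _ ≤ δ * 0.05 := by
        apply mul_le_mul_of_nonneg_left _ hδ0
        rw [div_le_iff₀ (by positivity)]; nlinarith

end Literature.NumberTheory.LFunctions.Zhang2022.Sec12WinExact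

open Literature.NumberTheory.LFunctions.Zhang2022.Skeleton
open Literature.NumberTheory.LFunctions.Zhang2022.Numerics (K0 K1 Dmain wExact wStarExact e2starW e2starBarW
  I6 I7 Z1214 ffj6 ffj7)
open Literature.NumberTheory.LFunctions.Zhang2022.Sec12WinExact

namespace Literature.NumberTheory.LFunctions.Zhang2022.Typed.Sec12C

/-! ## §1. The exact weight `𝓦ˣ_j(P^z)` in the variables of the proof of Lemma 12.3 -/

section Rewrite

variable (c' : ℝ) {D : ℕ}

/-- `P″₂/P^z = exp(log P · V)` with `V = (0.5 − z) + (𝓛 + 519 log 𝓛)/log P` (`P″₂ = P^{0.5}Dt₀`, `D = e^𝓛`, `t₀ = 𝓛⁵¹⁹`).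
[cite: Zhang2022LandauSiegel, §12 p.67 (definition of `P″₂`)] -/
theorem P2pp_div_rpow_eq (hD : 1 ≤ Real.log D) (z : ℝ) :
    P2pp D / bigP D ^ z =
      Real.exp (Real.log (bigP D) * (0.5 - z + (ell D + 519 * Real.log (ell D)) / Real.log (bigP D))) := by
  have hℓ : 0 < ell D := by rw [ell]; linarith
  have hL : 0 < Real.log (bigP D) := log_bigP_pos_of_one_le hD
  have hD0 : (0 : ℝ) < D := Sec12D.natCast_pos_of_one_le_log hD
  have hP : 0 < bigP D := Skeleton.bigP_pos D
  have e1 : Real.log (bigP D) * (0.5 - z + (ell D + 519 * Real.log (ell D)) / Real.log (bigP D)) =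
      Real.log (bigP D) * 0.5 + (ell D + 519 * Real.log (ell D)) - Real.log (bigP D) * z := by
    field_simp; ring
  rw [e1, Real.exp_sub, Real.exp_add, Real.exp_add, P2pp, Real.rpow_def_of_pos hP, Real.rpow_def_of_pos hP]
  congr 1
  rw [show Real.exp (ell D) = (D : ℝ) by rw [ell, Real.exp_log hD0],
    show Real.exp (519 * Real.log (ell D)) = t0 D by
      rw [t0, show (519 : ℝ) * Real.log (ell D) = Real.log (ell D ^ 519) by
        rw [Real.log_pow]; norm_num, Real.exp_log (pow_pos hℓ _)]]
  ring_nf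

/-- **The exact weight at `y = P^z`, substituted** (`t = e^{v log P}` in the two moments of the proof of Lemma 12.3, p. 70):
with `L = log P`, `M = log(Dt₀) = 𝓛 + 519 log 𝓛`, `V = (0.5 − z) + M/L`,
`𝓦ˣ_j(P^z) = −e^{β₆((z−0.496)L − M)}·[1 − β_{j+1}β_{j+2}·L²K₁(V) − ((z−0.496)L − M)(−β₆+β_{j+1}+β_{j+2} + β_{j+1}β_{j+2}·L K₀(V))]`
(`K₀, K₁` = `Numerics.K0/K1`, using `β₆ log P = 3πi/2`). [cite: Zhang2022LandauSiegel, §12 proof of Lemma 12.3, p. 70] -/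
theorem frakwEx_rpow_eq (hD : 1 ≤ Real.log D) (j : ℕ) (z : ℝ) :
    frakwEx c' D j (bigP D ^ z) =
      -(cexp (beta6 D * (((z - 0.496) * Real.log (bigP D) - (ell D + 519 * Real.log (ell D)) : ℝ) : ℂ)) *
        ((1 - betaJ c' D (j + 1) * betaJ c' D (j + 2) *
            ((Real.log (bigP D) : ℂ) ^ 2 *
              K1 (0.5 - z + (ell D + 519 * Real.log (ell D)) / Real.log (bigP D)))) -
          (((z - 0.496) * Real.log (bigP D) - (ell D + 519 * Real.log (ell D)) : ℝ) : ℂ) *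
            (-beta6 D + betaJ c' D (j + 1) + betaJ c' D (j + 2) +
              betaJ c' D (j + 1) * betaJ c' D (j + 2) *
                ((Real.log (bigP D) : ℂ) *
                  K0 (0.5 - z + (ell D + 519 * Real.log (ell D)) / Real.log (bigP D)))))) := by
  have hℓ1 : 1 ≤ ell D := by rw [ell]; exact hD
  have hL : 0 < Real.log (bigP D) := log_bigP_pos_of_one_le hD
  have hA : ((alpha D : ℝ) : ℂ) * (Real.log (bigP D) : ℝ) = (π : ℂ) := by
    rw [← Complex.ofReal_mul, alpha_mul_log_bigP D hℓ1]
  have hβL : beta6 D * (Real.log (bigP D) : ℂ) = 3 * π * I / 2 := by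
    rw [beta6]; linear_combination (3 * I / 2) * hA
  set L : ℝ := Real.log (bigP D) with hLdef
  set M : ℝ := ell D + 519 * Real.log (ell D) with hMdef
  set V : ℝ := 0.5 - z + M / L with hVdef
  have hx : 0 < bigP D ^ z / P1pp D :=
    div_pos (Real.rpow_pos_of_pos (Skeleton.bigP_pos D) z) (Sec12D.P1pp_pos hD)
  have hlog : Real.log (bigP D ^ z / P1pp D) = (z - 0.496) * L - M := by
    rw [Sec12D.log_rpow_div_P1pp hD z, hMdef]; ring
  have hcpow : ((bigP D ^ z / P1pp D : ℝ) : ℂ) ^ beta6 D =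
      cexp (beta6 D * ((((z - 0.496) * L - M : ℝ)) : ℂ)) := by
    rw [Complex.cpow_def_of_ne_zero (Complex.ofReal_ne_zero.mpr hx.ne'), ← Complex.ofReal_log hx.le,
      hlog, mul_comm]
  have hX : P2pp D / bigP D ^ z = Real.exp (L * V) := by
    rw [hVdef, hMdef, hLdef]; exact P2pp_div_rpow_eq hD z
  have hK0 : (∫ t in (1 : ℝ)..(P2pp D / bigP D ^ z), (t : ℂ) ^ (beta6 D - 1)) = (L : ℂ) * K0 V := by
    rw [hX, integral_cpow_sub_one_eq]
    congr 1
    unfold Numerics.K0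
    refine intervalIntegral.integral_congr fun v _ => ?_
    rw [← mul_assoc, hβL]; ring_nf
  have hK1 : (∫ t in (1 : ℝ)..(P2pp D / bigP D ^ z), (t : ℂ) ^ (beta6 D - 1) * (Real.log t : ℂ)) =
      (L : ℂ) ^ 2 * K1 V := by
    rw [hX, integral_cpow_sub_one_mul_log_eq]
    congr 1
    unfold Numerics.K1
    refine intervalIntegral.integral_congr fun v _ => ?_
    rw [← mul_assoc (beta6 D), hβL]; ring_nf
  unfold frakwEx
  rw [hcpow, hK0, hK1, hlog]
  ring

end Rewrite


/-! ## §2. The exact weight `𝓦ˣ_j(P^z)` is within `10r` of its main value `wExact j z` on the window -/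

section Window

variable (c' : ℝ) {D : ℕ}

/-- The window estimate for `𝓦ˣ_j(P^z)`, generic in the per-`j` data `(n, q, ρ, σ)`:
`β_{j+1}β_{j+2}log²P = −π²(n + ρ)`, `(−β₆+β_{j+1}+β_{j+2})log P = iπ(q + σ)` and the main value
`wExact j z = −e^{3πiu/2}[1 + π²nK₁(V₀) − u(iπq − π²nK₀(V₀))]`; the perturbations are `O((1+|c′|)²·α𝓛)`.
[cite: Zhang2022LandauSiegel, §12 proof of Lemma 12.3 p.70, (12.13) p.71] -/
theorem frakwEx_window_core (hD : 1 ≤ Real.log D) {r : ℝ} (hr : r ≤ 1 / 100)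
    (hK : (530 + 26 * |c'| + 15 * c' ^ 2) * (alpha D * ell D) ≤ r) {j : ℕ} {n q ρ σ : ℝ}
    (hn0 : 0 ≤ n) (hn : n ≤ 6) (hq : |q| ≤ 7 / 2)
    (hρ : |ρ| ≤ (18 * |c'| + 15 * c' ^ 2) * (alpha D * ell D)) (hσ : |σ| ≤ 8 * |c'| * (alpha D * ell D))
    (key_B : betaJ c' D (j + 1) * betaJ c' D (j + 2) * (Real.log (bigP D) : ℂ) ^ 2 = -(π : ℂ) ^ 2 * (n + ρ))
    (key_S : (-beta6 D + betaJ c' D (j + 1) + betaJ c' D (j + 2)) * (Real.log (bigP D) : ℂ) =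
      I * π * (q + σ))
    (hmain : ∀ z : ℝ, wExact j z = -(cexp (3 * π * I * ((z - 0.496 : ℝ) : ℂ) / 2) *
      (1 + π ^ 2 * n * K1 (0.004 - (z - 0.496)) -
        ((z - 0.496 : ℝ) : ℂ) * (I * π * q - π ^ 2 * n * K0 (0.004 - (z - 0.496)))))) :
    ∀ z ∈ Set.Icc (0.496 : ℝ) 0.5, ‖frakwEx c' D j (bigP D ^ z) - wExact j z‖ ≤ 10 * r := by
  intro z hz
  obtain ⟨hz1, hz2⟩ := hz
  have hℓ1 : 1 ≤ ell D := by rw [ell]; exact hD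
  have hℓ : 0 < ell D := by linarith
  have hL : 0 < Real.log (bigP D) := log_bigP_pos_of_one_le hD
  have hα : 0 < alpha D := Sec12D.alpha_pos_of_log hD
  have hAr : alpha D * Real.log (bigP D) = π := Sec12D.alpha_mul_logP hD
  have hA : ((alpha D : ℝ) : ℂ) * (Real.log (bigP D) : ℝ) = (π : ℂ) := by
    rw [← Complex.ofReal_mul, hAr]
  -- the small parameters `a = α𝓛`, `m = α·log(Dt₀)`
  have ha0 : 0 ≤ alpha D * ell D := mul_nonneg hα.le hℓ.le
  have hc0 : 0 ≤ 26 * |c'| + 15 * c' ^ 2 := by positivity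
  have har : 530 * (alpha D * ell D) ≤ r := by nlinarith
  have hr0 : 0 ≤ r := by linarith
  have ha1 : alpha D * ell D ≤ 1 := by nlinarith
  have hlogℓ : 0 ≤ Real.log (ell D) := Real.log_nonneg hℓ1
  have hM0 : 0 ≤ ell D + 519 * Real.log (ell D) := by positivity
  have hM : ell D + 519 * Real.log (ell D) ≤ 520 * ell D := by
    have : Real.log (ell D) ≤ ell D := (Real.log_le_sub_one_of_pos hℓ).trans (by linarith)
    nlinarith
  have hm0 : 0 ≤ alpha D * (ell D + 519 * Real.log (ell D)) := mul_nonneg hα.le hM0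
  have hm : alpha D * (ell D + 519 * Real.log (ell D)) ≤ r := by
    calc alpha D * (ell D + 519 * Real.log (ell D)) ≤ alpha D * (520 * ell D) :=
          mul_le_mul_of_nonneg_left hM hα.le
      _ ≤ r := by nlinarith
  have hρ' : |ρ| ≤ r := by
    refine hρ.trans ?_
    have : (18 * |c'| + 15 * c' ^ 2) * (alpha D * ell D) ≤ (26 * |c'| + 15 * c' ^ 2) * (alpha D * ell D) :=
      mul_le_mul_of_nonneg_right (by nlinarith [abs_nonneg c']) ha0
    nlinarith [abs_nonneg c']
  have hσ' : |σ| ≤ r := by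
    refine hσ.trans ?_
    nlinarith [abs_nonneg c', sq_nonneg c']
  -- the core bound at `u = z − 0.496`
  have core := core_window_bound (u := z - 0.496) (m := alpha D * (ell D + 519 * Real.log (ell D)))
    hn0 hn hq (by linarith) (by linarith) hρ' hσ' hm0 hm hr
  -- rewrite the level-`D` weight into the core form
  have hexp : beta6 D * ((((z - 0.496) * Real.log (bigP D) - (ell D + 519 * Real.log (ell D)) : ℝ)) : ℂ) =
      3 * π * I * ((z - 0.496 : ℝ) : ℂ) / 2 -
        3 * I * ((alpha D * (ell D + 519 * Real.log (ell D)) : ℝ) : ℂ) / 2 := by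
    rw [beta6]; push_cast
    linear_combination (3 * I * ((z : ℂ) - 0.496) / 2) * hA
  have hML : Real.log (bigP D) * (alpha D * (ell D + 519 * Real.log (ell D)) / π) =
      ell D + 519 * Real.log (ell D) := by
    rw [show Real.log (bigP D) * (alpha D * (ell D + 519 * Real.log (ell D)) / π) =
      (alpha D * Real.log (bigP D)) * (ell D + 519 * Real.log (ell D)) / π by ring, hAr]
    field_simp
  have hcast : ((((z - 0.496) * Real.log (bigP D) - (ell D + 519 * Real.log (ell D)) : ℝ)) : ℂ) =
      (Real.log (bigP D) : ℂ) *
        (((z - 0.496 : ℝ) : ℂ) - ((alpha D * (ell D + 519 * Real.log (ell D)) : ℝ) : ℂ) / π) := by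
    have e : (z - 0.496) * Real.log (bigP D) - (ell D + 519 * Real.log (ell D)) =
        Real.log (bigP D) * ((z - 0.496) - alpha D * (ell D + 519 * Real.log (ell D)) / π) := by
      rw [mul_sub, hML]; ring
    rw [e]; push_cast; ring
  have hV : 0.5 - z + (ell D + 519 * Real.log (ell D)) / Real.log (bigP D) =
      0.004 - (z - 0.496) + alpha D * (ell D + 519 * Real.log (ell D)) / π := by
    have e : (ell D + 519 * Real.log (ell D)) / Real.log (bigP D) =
        alpha D * (ell D + 519 * Real.log (ell D)) / π := by
      rw [div_eq_div_iff hL.ne' Real.pi_ne_zero, ← hAr]; ring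
    rw [e]; ring
  rw [frakwEx_rpow_eq c' hD j z, hexp, hcast, hV, hmain z]
  refine le_of_eq_of_le ?_ core
  congr 1
  -- the bracket identity (uses `key_B`, `key_S`)
  linear_combination (-(K1 (0.004 - (z - 0.496) + alpha D * (ell D + 519 * Real.log (ell D)) / π)) -
      (((z - 0.496 : ℝ) : ℂ) - ((alpha D * (ell D + 519 * Real.log (ell D)) : ℝ) : ℂ) / π) *
        K0 (0.004 - (z - 0.496) + alpha D * (ell D + 519 * Real.log (ell D)) / π)) *
      (-cexp (3 * π * I * ((z - 0.496 : ℝ) : ℂ) / 2 -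
        3 * I * ((alpha D * (ell D + 519 * Real.log (ell D)) : ℝ) : ℂ) / 2)) * key_B +
    (-(((z - 0.496 : ℝ) : ℂ) - ((alpha D * (ell D + 519 * Real.log (ell D)) : ℝ) : ℂ) / π)) *
      (-cexp (3 * π * I * ((z - 0.496 : ℝ) : ℂ) / 2 -
        3 * I * ((alpha D * (ell D + 519 * Real.log (ell D)) : ℝ) : ℂ) / 2)) * key_S

/-- **The exact weight `𝓦ˣ_j(P^z)` is within `10r` of `Numerics.wExact j z` on `[0.496, 0.5]`** (`j = 1,2,3`) once
`(530 + 26|c′| + 15c′²)·α𝓛 ≤ r ≤ 1/100`: by (2.13), (2.22) and `α log P = π`,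
`β_{j+1}β_{j+2}log²P = −n_jπ²(1 + O(c′α𝓛))`, `(−β₆+β_{j+1}+β_{j+2})log P = (9/2 − j)πi + O(c′α𝓛)`,
`(P^z/P″₁)^{β₆} = e^{3πiu/2}e^{−(3/2)iα log(Dt₀)}`, `log(P″₂/P^z)/log P = 0.004 − u + α log(Dt₀)/π`.
[cite: Zhang2022LandauSiegel, §12 proof of Lemma 12.3 p.70, (12.13) p.71] -/
theorem frakwEx_sub_wExact_le (hD : 1 ≤ Real.log D) {r : ℝ} (hr : r ≤ 1 / 100)
    (hK : (530 + 26 * |c'| + 15 * c' ^ 2) * (alpha D * ell D) ≤ r) :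
    ∀ j ∈ ({1, 2, 3} : Finset ℕ), ∀ z ∈ Set.Icc (0.496 : ℝ) 0.5,
      ‖frakwEx c' D j (bigP D ^ z) - wExact j z‖ ≤ 10 * r := by
  have hℓ1 : 1 ≤ ell D := by rw [ell]; exact hD
  have hAr : alpha D * Real.log (bigP D) = π := Sec12D.alpha_mul_logP hD
  have hA : ((alpha D : ℝ) : ℂ) * (Real.log (bigP D) : ℝ) = (π : ℂ) := by
    rw [← Complex.ofReal_mul, hAr]
  have ha0 : 0 ≤ alpha D * ell D :=
    mul_nonneg (Sec12D.alpha_pos_of_log hD).le (by linarith : (0:ℝ) ≤ ell D)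
  have hc0 : 0 ≤ 26 * |c'| + 15 * c' ^ 2 := by positivity
  have ha1 : alpha D * ell D ≤ 1 := by nlinarith
  have hsq : (c' * (alpha D * ell D)) ^ 2 ≤ c' ^ 2 * (alpha D * ell D) := by
    calc (c' * (alpha D * ell D)) ^ 2 = c' ^ 2 * ((alpha D * ell D) * (alpha D * ell D)) := by ring
      _ ≤ c' ^ 2 * ((alpha D * ell D) * 1) := by gcongr
      _ = c' ^ 2 * (alpha D * ell D) := by ring
  have hxle : c' * (alpha D * ell D) ≤ |c'| * (alpha D * ell D) :=
    mul_le_mul_of_nonneg_right (le_abs_self c') ha0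
  have hxge : -(|c'| * (alpha D * ell D)) ≤ c' * (alpha D * ell D) := by
    have := mul_le_mul_of_nonneg_right (neg_abs_le c') ha0; linarith
  have hca0 : 0 ≤ |c'| * (alpha D * ell D) := mul_nonneg (abs_nonneg c') ha0
  have hcsq0 : 0 ≤ c' ^ 2 * (alpha D * ell D) := mul_nonneg (sq_nonneg c') ha0
  intro j hj
  simp only [Finset.mem_insert, Finset.mem_singleton] at hj
  rcases hj with rfl | rfl | rfl
  · -- j = 1: B = β₂β₃, n = 6, q = 7/2, ρ = −6(c′a)², σ = −c′a
    refine frakwEx_window_core c' hD hr hK (n := 6) (q := 7 / 2) (ρ := -6 * (c' * (alpha D * ell D)) ^ 2)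
      (σ := -(c' * (alpha D * ell D))) (by norm_num) (by norm_num) (by norm_num) ?_ ?_ ?_ ?_ ?_
    · rw [abs_le]; constructor <;> nlinarith [sq_nonneg (c' * (alpha D * ell D))]
    · rw [abs_le]; constructor <;> nlinarith
    · norm_num only [betaJ, beta1, beta2, beta3]
      push_cast
      linear_combination (-6 * (1 + (c' : ℂ) * ((alpha D : ℂ) * (ell D : ℂ))) *
        (1 - (c' : ℂ) * ((alpha D : ℂ) * (ell D : ℂ))) *
          ((alpha D : ℂ) * (Real.log (bigP D) : ℂ) + π)) * hA +
        (6 * (alpha D : ℂ) ^ 2 * (Real.log (bigP D) : ℂ) ^ 2 *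
          (1 - (alpha D : ℂ) ^ 2 * (c' : ℂ) ^ 2 * (ell D : ℂ) ^ 2)) * Complex.I_sq
    · norm_num only [betaJ, beta6, beta1, beta2, beta3]
      push_cast
      linear_combination (I * (7 / 2 - (c' : ℂ) * ((alpha D : ℂ) * (ell D : ℂ)))) * hA
    · intro z
      unfold Numerics.wExact Numerics.Dmain
      norm_num only [Numerics.nj]
      push_cast
      ring
  · -- j = 2: B = β₃β₁, n = 3, q = 5/2, ρ = −18c′a + 15(c′a)², σ = −8c′a
    refine frakwEx_window_core c' hD hr hK (n := 3) (q := 5 / 2)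
      (ρ := -18 * (c' * (alpha D * ell D)) + 15 * (c' * (alpha D * ell D)) ^ 2)
      (σ := -8 * (c' * (alpha D * ell D))) (by norm_num) (by norm_num) (by norm_num) ?_ ?_ ?_ ?_ ?_
    · rw [abs_le]; constructor <;> nlinarith [sq_nonneg (c' * (alpha D * ell D))]
    · rw [abs_le]; constructor <;> nlinarith
    · norm_num only [betaJ, beta1, beta2, beta3]
      push_cast
      linear_combination (-3 * (1 - (c' : ℂ) * ((alpha D : ℂ) * (ell D : ℂ))) *
        (1 - 5 * (c' : ℂ) * ((alpha D : ℂ) * (ell D : ℂ))) *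
          ((alpha D : ℂ) * (Real.log (bigP D) : ℂ) + π)) * hA +
        ((alpha D : ℂ) ^ 2 * (Real.log (bigP D) : ℂ) ^ 2 *
          (3 - 18 * (alpha D : ℂ) * (c' : ℂ) * (ell D : ℂ) +
            15 * (alpha D : ℂ) ^ 2 * (c' : ℂ) ^ 2 * (ell D : ℂ) ^ 2)) * Complex.I_sq
    · norm_num only [betaJ, beta6, beta1, beta2, beta3]
      push_cast
      linear_combination (I * (5 / 2 - 8 * (c' : ℂ) * ((alpha D : ℂ) * (ell D : ℂ)))) * hA
    · intro z
      unfold Numerics.wExact Numerics.Dmain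
      norm_num only [Numerics.nj]
      push_cast
      ring
  · -- j = 3: B = β₁β₂, n = 2, q = 3/2, ρ = −8c′a − 10(c′a)², σ = −3c′a
    refine frakwEx_window_core c' hD hr hK (n := 2) (q := 3 / 2)
      (ρ := -8 * (c' * (alpha D * ell D)) - 10 * (c' * (alpha D * ell D)) ^ 2)
      (σ := -3 * (c' * (alpha D * ell D))) (by norm_num) (by norm_num) (by norm_num) ?_ ?_ ?_ ?_ ?_
    · rw [abs_le]; constructor <;> nlinarith [sq_nonneg (c' * (alpha D * ell D))]
    · rw [abs_le]; constructor <;> nlinarith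
    · norm_num only [betaJ, beta1, beta2, beta3]
      push_cast
      linear_combination (-2 * (1 - 5 * (c' : ℂ) * ((alpha D : ℂ) * (ell D : ℂ))) *
        (1 + (c' : ℂ) * ((alpha D : ℂ) * (ell D : ℂ))) *
          ((alpha D : ℂ) * (Real.log (bigP D) : ℂ) + π)) * hA +
        ((alpha D : ℂ) ^ 2 * (Real.log (bigP D) : ℂ) ^ 2 *
          (2 - 8 * (alpha D : ℂ) * (c' : ℂ) * (ell D : ℂ) -
            10 * (alpha D : ℂ) ^ 2 * (c' : ℂ) ^ 2 * (ell D : ℂ) ^ 2)) * Complex.I_sq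
    · norm_num only [betaJ, beta6, beta1, beta2, beta3]
      push_cast
      linear_combination (I * (3 / 2 - 3 * (c' : ℂ) * ((alpha D : ℂ) * (ell D : ℂ)))) * hA
    · intro z
      unfold Numerics.wExact Numerics.Dmain
      norm_num only [Numerics.nj]
      push_cast
      ring

/-- `z ↦ 𝓦ˣ_j(P^z)` is continuous (for `log D ≥ 1`): by `frakwEx_rpow_eq` it is built from `exp`, affine maps and
`K₀, K₁` (continuous, `continuous_K0_K1`). [cite: Zhang2022LandauSiegel, §12 proof of Lemma 12.3 p.70] -/
theorem continuous_frakwEx_rpow (hD : 1 ≤ Real.log D) (j : ℕ) :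
    Continuous fun z : ℝ => frakwEx c' D j (bigP D ^ z) := by
  have e : (fun z : ℝ => frakwEx c' D j (bigP D ^ z)) = fun z : ℝ =>
      -(cexp (beta6 D * (((z - 0.496) * Real.log (bigP D) - (ell D + 519 * Real.log (ell D)) : ℝ) : ℂ)) *
        ((1 - betaJ c' D (j + 1) * betaJ c' D (j + 2) *
            ((Real.log (bigP D) : ℂ) ^ 2 *
              K1 (0.5 - z + (ell D + 519 * Real.log (ell D)) / Real.log (bigP D)))) -
          (((z - 0.496) * Real.log (bigP D) - (ell D + 519 * Real.log (ell D)) : ℝ) : ℂ) *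
            (-beta6 D + betaJ c' D (j + 1) + betaJ c' D (j + 2) +
              betaJ c' D (j + 1) * betaJ c' D (j + 2) *
                ((Real.log (bigP D) : ℂ) *
                  K0 (0.5 - z + (ell D + 519 * Real.log (ell D)) / Real.log (bigP D)))))) := by
    funext z; exact frakwEx_rpow_eq c' hD j z
  obtain ⟨hK0, hK1⟩ := continuous_K0_K1
  rw [e]
  fun_prop

end Window


/-! ## §3. The leaf: `Win1217Ex c′` holds for every `c′` -/

section Leaf

/-- The main values `wExact j`, `wStarExact j` are continuous. [folklore] -/
private theorem continuous_wExact_wStarExact (j : ℕ) : Continuous (wExact j) ∧ Continuous (wStarExact j) := by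
  obtain ⟨hK0, hK1⟩ := continuous_K0_K1
  constructor
  · have e : wExact j = fun z => -Dmain j (z - 0.496) := by funext z; rfl
    rw [e]; unfold Numerics.Dmain; fun_prop
  · have e : wStarExact j = fun z : ℝ =>
        -(cexp (-(3 * π * I * ((z : ℂ) - 0.496) / 2)) * (1 - (3 / 2 - (j : ℂ)) * π * I * ((z : ℂ) - 0.496))) := by
      funext z; rfl
    rw [e]; fun_prop

/-- The level-`D` window values are the `Numerics` functionals at the level-`D` weights (same shapes; `𝔣𝔣_{jμ}` by
`j`-index on both sides). [cite: Zhang2022LandauSiegel, §12 (12.15)–(12.16) pp.72–73] -/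
theorem e2starEx_eq_e2starW (c' : ℝ) (D : ℕ) :
    e2starEx c' D = e2starW (fun j z => frakwEx c' D j (bigP D ^ z)) ∧
      e2starBarEx c' D = e2starBarW (fun j z => frakwStarEx c' D j (bigP D ^ z)) := ⟨rfl, rfl⟩

/-- **`Z22:(12.17)` numerical content in the EXACT reading — the RT-02 node `Win1217Ex` HOLDS for every `c′`:**
for all large `D` (all real primitive `χ` mod `D`),
`‖Σ_j (w_j/α)·main1213intEx_j + conj(Σ_j (w_j/α)·main12u049intEx_j) − 2𝔞e₂*‖ ≤ 5·10⁻⁶·𝔞`.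
Proof: the weighted sums are `𝔞·e2starEx`, `𝔞·e2starBarEx` (`α log P = π`, `Sec12C.weighted_main1213intEx_eq`,
`weighted_main12u049intEx_eq`); the level-`D` weights are within `10⁻⁵` of Zhang's main values `wExact`, `wStarExact`
on the windows for `D ≥ D₀(c′)` (`frakwEx_sub_wExact_le`, `Sec12D.wStarEx_sub_wStarExact_le`), the window functionals are
Lipschitz with constants `0.05` and `0.055` (`e2starW_sub_le_of_close`, `Sec12D.e2starBarW_sub_le_of_close`), and the main value is
kernel-certified: `‖e₂*(𝓦ˣ) + conj ē₂*(𝓦*ˣ) − 2e₂*‖ < 3.6·10⁻⁶` (`Numerics.eq1217_exact_lt_36`, box `Numerics.E17x`);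
budget `3.6·10⁻⁶ + 10⁻⁵·0.05 + 10⁻⁵·0.055 = 4.65·10⁻⁶ ≤ 5·10⁻⁶`. No hypothesis, no (A): a statement about the explicit
closed forms of the manuscript's own main terms. [cite: Zhang2022LandauSiegel, §12 (12.15)–(12.17) pp.72–73] -/
theorem win1217Ex_holds (c' : ℝ) : Win1217Ex c' := by
  obtain ⟨D₁, hD₁⟩ := ell_large ((530 + 26 * |c'| + 15 * c' ^ 2) * π) 1e-6 (by positivity) (by norm_num)
  obtain ⟨D₂, hD₂⟩ := ell_large
    (1.02 * (780 * π) + (0.004 * (8 * |c'| * π ^ 2) + 520 * π * (3 / 2 + 8 * |c'| * π))) 1e-5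
    (by positivity) (by norm_num)
  refine ⟨max D₁ D₂, fun D _ χ hD _ _ => ?_⟩
  obtain ⟨hL1, hK1⟩ := hD₁ D (le_trans (le_max_left _ _) hD)
  obtain ⟨-, hK2⟩ := hD₂ D (le_trans (le_max_right _ _) hD)
  have hlog : 1 ≤ Real.log D := hL1
  have hℓ : 0 < ell D := by linarith
  -- the two window estimates
  have hK : (530 + 26 * |c'| + 15 * c' ^ 2) * (alpha D * ell D) ≤ 1e-6 := by
    rw [alpha_mul_ell D hL1, ← mul_div_assoc]; exact hK1
  have hw := frakwEx_sub_wExact_le c' hlog (r := 1e-6) (by norm_num) hK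
  have hws := Sec12D.wStarEx_sub_wStarExact_le c' hL1 hK2
  -- continuity of the four weight families
  have hcw : ∀ j ∈ ({1, 2, 3} : Finset ℕ), Continuous (fun z : ℝ => frakwEx c' D j (bigP D ^ z)) :=
    fun j _ => continuous_frakwEx_rpow c' hlog j
  have hcws : ∀ j ∈ ({1, 2, 3} : Finset ℕ), Continuous (fun z : ℝ => frakwStarEx c' D j (bigP D ^ z)) :=
    fun j _ => Sec12D.continuous_wStarEx_rpow c' hL1 j
  have hcE : ∀ j ∈ ({1, 2, 3} : Finset ℕ), Continuous (wExact j) :=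
    fun j _ => (continuous_wExact_wStarExact j).1
  have hcEs : ∀ j ∈ ({1, 2, 3} : Finset ℕ), Continuous (wStarExact j) :=
    fun j _ => (continuous_wExact_wStarExact j).2
  -- the two functional bounds
  have h1 : ‖e2starW (fun j z => frakwEx c' D j (bigP D ^ z)) - e2starW wExact‖ ≤ 1e-5 * 0.05 :=
    e2starW_sub_le_of_close (by norm_num) hcw hcE (fun j hj z hz => (hw j hj z hz).trans (by norm_num))
  have h2 : ‖e2starBarW (fun j z => frakwStarEx c' D j (bigP D ^ z)) - e2starBarW wStarExact‖ ≤ 1e-5 * 0.055 :=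
    Sec12D.e2starBarW_sub_le_of_close (by norm_num) hcws hcEs (fun j hj z hz => hws j hj z hz)
  have hcert := Numerics.eq1217_exact_lt_36
  obtain ⟨e1, e2⟩ := e2starEx_eq_e2starW c' D
  -- bookkeeping: factor `𝔞`
  rw [weighted_main1213intEx_eq c' χ hlog, weighted_main12u049intEx_eq c' χ hlog]
  have hA0 := frakA_nonneg χ
  have e3 : (frakA χ : ℂ) * e2starEx c' D + conj ((frakA χ : ℂ) * e2starBarEx c' D) - 2 * frakA χ * e2star =
      (frakA χ : ℂ) * ((e2starEx c' D + conj (e2starBarEx c' D)) - 2 * e2star) := by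
    rw [map_mul, Complex.conj_ofReal]; ring
  rw [e3, norm_mul, Complex.norm_real, Real.norm_of_nonneg hA0, mul_comm]
  refine mul_le_mul_of_nonneg_right ?_ hA0
  -- the window budget
  rw [e1, e2]
  set E := e2starW (fun j z => frakwEx c' D j (bigP D ^ z)) with hE
  set Es := e2starBarW (fun j z => frakwStarEx c' D j (bigP D ^ z)) with hEs
  have e4 : (E + conj Es) - 2 * e2star = ((e2starW wExact + conj (e2starBarW wStarExact)) - 2 * e2star) +
      ((E - e2starW wExact) + conj (Es - e2starBarW wStarExact)) := by
    rw [map_sub]; ring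
  rw [e4]
  calc ‖((e2starW wExact + conj (e2starBarW wStarExact)) - 2 * e2star) +
        ((E - e2starW wExact) + conj (Es - e2starBarW wStarExact))‖
      ≤ ‖(e2starW wExact + conj (e2starBarW wStarExact)) - 2 * e2star‖ +
          ‖(E - e2starW wExact) + conj (Es - e2starBarW wStarExact)‖ := norm_add_le _ _
    _ ≤ ‖(e2starW wExact + conj (e2starBarW wStarExact)) - 2 * e2star‖ +
          (‖E - e2starW wExact‖ + ‖conj (Es - e2starBarW wStarExact)‖) := by
        gcongr; exact norm_add_le _ _
    _ ≤ 3.6e-6 + (1e-5 * 0.05 + 1e-5 * 0.055) := by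
        rw [RCLike.norm_conj]
        exact add_le_add hcert.le (add_le_add h1 h2)
    _ ≤ 5e-6 := by norm_num

variable (c' : ℝ) in
/-- `Win1217Ex` — `_holds` alias of `win1217Ex_holds` above under the fact's exact name, stated under the
prover's own binders as section variables (appended 2026-08-28, D-0026 bookkeeping: the proof term is the
existing theorem of this file; no statement, definition or attribute is edited; no new named fact; the
ledger's debt table listed the fact unproved). [cite: Zhang2022LandauSiegel, §12 (12.15)–(12.17) pp.72–73] -/
theorem _root_.Literature.NumberTheory.LFunctions.Zhang2022.Typed.Sec12C.Win1217Ex_holds :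
    _root_.Literature.NumberTheory.LFunctions.Zhang2022.Typed.Sec12C.Win1217Ex c' :=
  _root_.Literature.NumberTheory.LFunctions.Zhang2022.Typed.Sec12C.win1217Ex_holds (c' := c')

end Leaf

end Literature.NumberTheory.LFunctions.Zhang2022.Typed.Sec12C
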